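import Summits.CriticalPhenomena.SAWScalingLimit.Theorems.SAWLeftRightFKGFKGToTraversalBoundObstacleTriplePockets
import HarnessLib

/-!
# Obstacle contacts along the wall-follower tour: the loop through two contacts (witness unit U5d, part 2)

Crux `SAWLeftRightFKG.FKGToTraversalBound` (stmt-CriticalPhenomena-1878), line `slit-necklace`, lead
prover-line-stmt-CriticalPhenomena-1878-c5-0; witness unit U5d (no bad triple of obstacle contacts along the tour),
on top of `…SlitNecklaceOutline` (`IsBEdge`, `bsite`, `bcontact`, `btour`), `…OutlineFaces` (`cornerFace`: the
tour as a walk of FACES), `…OutlineAbab` (`abab_walkWinding_ne_of_sepEdge_mem`) and part 1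
`…ObstacleTriplePockets` (`triple_slice`, `triple_walkWinding_face`).

Setting: `A ⊆ ℤ²` finite and `4`-connected, `e` a boundary edge of `A` whose tour has the injective period `N`,
`r : u ⟶ v` a lattice PATH avoiding `A` (the obstacle) with escapes `εu`, `εv` from its endpoints and an escape
from every non-`A` site adjacent to `A` off the interior of `r`, all to the right of the column `Rbig`, which
lies to the right of `A ∪ r`.  Suppose the contacts of the tour positions `0 < y < z < N` are the interior
`r`-vertices `r_{mx}`, `r_{my'}`, `r_{mz}` with `mx < mz` and `my' ∉ [mx, mz]`.

Registered helper `triple_arc_contacts`: then EVERY position `z < j < N` has as contact an `r`-vertex `r_k` with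
`mx ≤ k ≤ mz`.

Proof (discrete planar topology by the tree's combinatorial winding number `walkWinding`, no Jordan curve
theorem), the construction of `…OutlineAbab` / `…OutlineSide` verbatim:
* `loop_build` — the closed lattice TRAIL `Ξ : bsite e → r_{mx} ⟶_r r_{mz} → bsite (btour z) ⟶_A bsite e`; its
  only `A`–`Aᶜ` edges are the primal edges of positions `0` and `z`;
* the tour faces `F j = cornerFace (btour A e j)` form a face walk crossing exactly the primal edges of the
  positions, so `walkWinding Ξ ∘ F` is constant on `[1, z]` and on `[z + 1, N]` and jumps across the primal edge
  of `e` (`F N = F 0`): the two arcs carry different values;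
* the contact `r_{my'}` of position `y` lies off `Ξ` and is joined to the column `Rbig` off `Ξ` (along `r`
  outside `[mx, mz]`, then `εu` or `εv`), where the winding number vanishes (`walkWinding_eq_zero_of_right`): the
  first arc reads `0`, so the second arc reads `≠ 0`;
* a contact of a position `z < j < N` off `Ξ` would likewise be joined to the column `Rbig` off `Ξ` (by a contact
  escape, or along `r`), reading `0`: so it is one of the `r_k`, `mx ≤ k ≤ mz`.

All statements folklore (boundary tracing of a polyomino; Kesten, *Percolation theory for mathematicians* (1982),
§2.2, already formalised in `PlanarDuality.lean` / `RandomClusterBoxDuality.lean`); no literature fact is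
introduced; nothing restates the crux.
-/

noncomputable section

open Set
open Literature.Probability.LatticeModels Literature.Probability.Percolation
open Literature.Probability.LatticeModels.SquareTiling (corners mem_corners_iff walkWinding_eq_of_walk_closed
  walkWinding_eq_of_mem_corners)

namespace Summit.CriticalPhenomena.SAWScalingLimit.Theorems.FKGToTraversalBound.SlitNecklace

/-! ### Small bookkeeping -/

/-- A boundary edge is determined by its outline site and its contact site. [folklore] -/
private theorem loop_eq_of_bsite_eq {e e' : Site 2 × ODir} (h₁ : bsite e = bsite e')
    (h₂ : bcontact e = bcontact e') : e = e' := by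
  obtain ⟨x, d⟩ := e
  obtain ⟨x', d'⟩ := e'
  simp only [bsite] at h₁
  subst h₁
  simp only [bcontact, add_right_inj] at h₂
  have h0 := congrFun h₂ 0
  have h1 := congrFun h₂ 1
  fin_cases d <;> fin_cases d' <;> simp [ODir.vec] at h0 h1 ⊢

/-- The face step of a boundary edge crosses its primal edge `{bsite, bcontact}`. [folklore] -/
private theorem loop_sepEdge_cornerFace (e : Site 2 × ODir) :
    sepEdge (cornerFace e) (cornerFace e + e.2.ccw.vec) = s(bsite e, bcontact e) := by
  obtain ⟨x, d⟩ := e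
  exact sepEdge_cornerFace x d

/-- A closed walk avoiding the contact site of a boundary edge winds equally about the start-corner face of
the edge and about the contact site. [folklore] -/
private theorem loop_face_contact {a : Site 2} (p : (zdGraph 2).Walk a a) (e : Site 2 × ODir)
    (h : bcontact e ∉ p.support) : walkWinding p (cornerFace e) = walkWinding p (bcontact e) := by
  obtain ⟨x, d⟩ := e
  exact triple_walkWinding_face p h (cornerFace_add_one_mem_corners_contact x d)

/-- **Constancy along a tour arc**: if the closed walk `p` uses none of the primal edges of the tour positions
`i ≤ j < b`, then `walkWinding p` takes the same value at all tour faces `cornerFace (btour A e₀ j)`,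
`i ≤ j ≤ b`. [folklore] -/
private theorem loop_arc_const {a : Site 2} (p : (zdGraph 2).Walk a a) (A : Set (Site 2)) (e₀ : Site 2 × ODir)
    {i b : ℕ} (h : ∀ j, i ≤ j → j < b → s(bsite (btour A e₀ j), bcontact (btour A e₀ j)) ∉ p.edges) :
    ∀ j, i ≤ j → j ≤ b → walkWinding p (cornerFace (btour A e₀ j)) = walkWinding p (cornerFace (btour A e₀ i)) := by
  intro j hij
  induction j, hij using Nat.le_induction with
  | base => exact fun _ => rfl
  | succ n hn ih =>
    intro hnb
    rw [cornerFace_btour_succ]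
    refine (walkWinding_closed_eq_of_adj (adj_cornerFace_add _) ?_).symm.trans (ih (Nat.le_of_succ_le hnb))
    rw [loop_sepEdge_cornerFace]
    exact h n hn (Nat.lt_of_succ_le hnb)

/-! ### The closed trail through two contacts -/

/-- **The loop.**  From the boundary edge `e` with contact `r_{mx}` and the position `z` with contact `r_{mz}`
(`mx < mz`, `r` a path avoiding `A`, no repeats of the tour before `N > z`): a closed lattice TRAIL `Ξ` at
`bsite e` through `bsite e → r_{mx} ⟶_r r_{mz} → bsite (btour z) ⟶_A bsite e`, with support in
`A ∪ {r_k : mx ≤ k ≤ mz}`, through the primal edge of `e`, and through no other primal edge of a tour position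
`0 < j < N` except that of `z`. [folklore] -/
private theorem loop_build (A : Finset (Site 2)) (e : Site 2 × ODir) (N : ℕ) {u v : Site 2}
    (r : (zdGraph 2).Walk u v) (z mx mz : ℕ) (he : IsBEdge (↑A : Set (Site 2)) e)
    (hinj : ∀ j j', j < N → j' < N → btour (↑A : Set (Site 2)) e j = btour (↑A : Set (Site 2)) e j' → j = j')
    (hr : r.IsPath) (hA : ∀ x' ∈ A, ∀ y' ∈ A, ∃ w : (zdGraph 2).Walk x' y', ∀ z' ∈ w.support, z' ∈ A)
    (hrA : ∀ z' ∈ r.support, z' ∉ A) (hzN : z < N) (hxz : mx < mz) (hmzL : mz ≤ r.length)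
    (h0 : bcontact e = r.getVert mx) (hz : bcontact (btour (↑A : Set (Site 2)) e z) = r.getVert mz) :
    ∃ Ξ : (zdGraph 2).Walk (bsite e) (bsite e),
      (∀ z' ∈ Ξ.support, z' ∈ A ∨ ∃ k, mx ≤ k ∧ k ≤ mz ∧ z' = r.getVert k) ∧ Ξ.edges.Nodup ∧
      s(bsite e, bcontact e) ∈ Ξ.edges ∧
      ∀ j, 0 < j → j < N → j ≠ z →
        s(bsite (btour (↑A : Set (Site 2)) e j), bcontact (btour (↑A : Set (Site 2)) e j)) ∉ Ξ.edges := by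
  classical
  have hinjr : ∀ i j, i ≤ r.length → j ≤ r.length → r.getVert i = r.getVert j → i = j :=
    fun i j hi hj h => hr.getVert_injOn (by simpa using hi) (by simpa using hj) h
  have he' := bcontact_spec _ he
  have hez := bcontact_spec _ (btour_isBEdge (↑A : Set (Site 2)) he z)
  obtain ⟨q, hqp, hqs, hqe⟩ := triple_slice hr hxz.le
  obtain ⟨α, hα⟩ := hA _ hez.1 _ he'.1
  have hωA : ∀ z' ∈ α.bypass.support, z' ∈ A := fun z' hz' => hα z' (α.support_bypass_subset_support hz')
  have hadj0 : (zdGraph 2).Adj (bsite e) (r.getVert mx) := by rw [← h0]; exact he'.2.2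
  have hadjz : (zdGraph 2).Adj (r.getVert mz) (bsite (btour (↑A : Set (Site 2)) e z)) := by
    rw [← hz]; exact hez.2.2.symm
  refine ⟨SimpleGraph.Walk.cons hadj0 (q.append (SimpleGraph.Walk.cons hadjz α.bypass)), ?_, ?_, ?_, ?_⟩
  · -- support
    intro z' hz'
    rw [SimpleGraph.Walk.support_cons, List.mem_cons, SimpleGraph.Walk.mem_support_append_iff,
      SimpleGraph.Walk.support_cons, List.mem_cons] at hz'
    rcases hz' with rfl | hz' | rfl | hz'
    · exact Or.inl he'.1
    · exact Or.inr (hqs z' hz')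
    · exact Or.inr ⟨mz, hxz.le, le_rfl, rfl⟩
    · exact Or.inl (hωA z' hz')
  · -- edges without repetition
    rw [SimpleGraph.Walk.edges_cons, List.nodup_cons, SimpleGraph.Walk.edges_append,
      SimpleGraph.Walk.edges_cons]
    refine ⟨fun h => ?_, List.nodup_append.2 ⟨hqp.edges_nodup, List.nodup_cons.2 ⟨fun h => ?_,
      α.bypass_isPath.edges_nodup⟩, ?_⟩⟩
    · rcases List.mem_append.1 h with h | h
      · exact hrA _ (r.fst_mem_support_of_mem_edges (hqe _ h)) he'.1
      rcases List.mem_cons.1 h with h | h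
      · rcases Sym2.eq_iff.1 h with ⟨h1, -⟩ | ⟨-, h2⟩
        · exact hrA _ (r.getVert_mem_support mz) (h1 ▸ he'.1)
        · exact absurd (hinjr mx mz (by omega) hmzL h2) (Nat.ne_of_lt hxz)
      · exact hrA _ (r.getVert_mem_support mx) (hωA _ (α.bypass.snd_mem_support_of_mem_edges h))
    · exact hrA _ (r.getVert_mem_support mz) (hωA _ (α.bypass.fst_mem_support_of_mem_edges h))
    · rintro s hs _ hs' rfl
      rcases List.mem_cons.1 hs' with rfl | hs'
      · exact hrA _ (r.snd_mem_support_of_mem_edges (hqe _ hs)) hez.1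
      · induction s using Sym2.ind with
        | _ a' b' =>
          exact hrA a' (r.fst_mem_support_of_mem_edges (hqe _ hs))
            (hωA a' (α.bypass.fst_mem_support_of_mem_edges hs'))
  · -- the primal edge of `e`
    rw [h0, SimpleGraph.Walk.edges_cons]
    exact List.mem_cons_self
  · -- no other primal edge of a tour position
    intro j hj0 hjN hjz hmem
    have hej := bcontact_spec _ (btour_isBEdge (↑A : Set (Site 2)) he j)
    simp only [SimpleGraph.Walk.edges_cons, SimpleGraph.Walk.edges_append, List.mem_cons,
      List.mem_append] at hmem
    rcases hmem with h | h | h | h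
    · rcases Sym2.eq_iff.1 h with ⟨h1, h2⟩ | ⟨h1, -⟩
      · have := hinj j 0 hjN (by omega)
          (by rw [btour_zero]; exact loop_eq_of_bsite_eq h1 (h2.trans h0.symm))
        omega
      · exact hrA _ (r.getVert_mem_support mx) (h1 ▸ hej.1)
    · exact hrA _ (r.fst_mem_support_of_mem_edges (hqe _ h)) hej.1
    · rcases Sym2.eq_iff.1 h with ⟨h1, -⟩ | ⟨h1, h2⟩
      · exact hrA _ (r.getVert_mem_support mz) (h1 ▸ hej.1)
      · exact hjz (hinj j z hjN hzN (loop_eq_of_bsite_eq h1 (h2.trans hz.symm)))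
    · exact hej.2.1 (hωA _ (α.bypass.snd_mem_support_of_mem_edges h))

/-! ### The registered helper -/

/-- **Registered helper (witness unit U5d, part 2): beyond a bad triple, every contact is on the obstacle
between the two outer contacts.**  With the tour of `A` from the boundary edge `e` (injective period `N`), the
obstacle path `r` avoiding `A`, escapes to the right of the column `Rbig` from `u`, `v` and from every non-`A`
neighbour of `A` off the interior of `r`, and contacts `r_{mx}`, `r_{my'}`, `r_{mz}` at positions `0 < y < z`
with `mx < mz`, `my' ∉ [mx, mz]`: every position `z < j < N` has contact `r_k` for some `mx ≤ k ≤ mz`.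
[folklore] -/
theorem triple_arc_contacts : ∀ (A : Finset (Site 2)) (e : Site 2 × ODir) (N : ℕ) {u v : Site 2} (r : (zdGraph 2).Walk u v) (Rbig : ℤ) (u₁ v₁ : Site 2) (εu : (zdGraph 2).Walk u u₁) (εv : (zdGraph 2).Walk v v₁) (y z mx my' mz : ℕ), IsBEdge (↑A : Set (Site 2)) e → btour (↑A : Set (Site 2)) e N = e → (∀ j j', j < N → j' < N → btour (↑A : Set (Site 2)) e j = btour (↑A : Set (Site 2)) e j' → j = j') → r.IsPath → (∀ x' ∈ A, ∀ y' ∈ A, ∃ w : (zdGraph 2).Walk x' y', ∀ z' ∈ w.support, z' ∈ A) → (∀ z' ∈ r.support, z' ∉ A) → (∀ z' : Site 2, (z' ∈ A ∨ z' ∈ r.support) → z' 0 + 2 ≤ Rbig) → Rbig ≤ u₁ 0 → Rbig ≤ v₁ 0 → (∀ z' ∈ εu.support, z' ∉ A ∧ ∀ n, 0 < n → n < r.length → z' ≠ r.getVert n) → (∀ z' ∈ εv.support, z' ∉ A ∧ ∀ n, 0 < n → n < r.length → z' ≠ r.getVert n) → (∀ c : Site 2, c ∉ A → (∀ n, 0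 < n → n < r.length → c ≠ r.getVert n) → (∃ a ∈ A, (zdGraph 2).Adj a c) → ∃ (c' : Site 2) (ε : (zdGraph 2).Walk c c'), Rbig ≤ c' 0 ∧ ∀ z' ∈ ε.support, z' ∉ A ∧ ∀ n, 0 < n → n < r.length → z' ≠ r.getVert n) → 0 < y → y < z → z < N → 0 < mx → my' < r.length → mz < r.length → bcontact e = r.getVert mx → bcontact (btour (↑A : Set (Site 2)) e y) = r.getVert my' → bcontact (btour (↑A : Set (Site 2)) e z) = r.getVert mz → mx < mz → (my' < mx ∨ mz < my') → ∀ j, z < j → j < N → ∃ k, mx ≤ k ∧ k ≤ mz ∧ bcontact (btour (↑A : Set (Site 2)) e j) = r.getVert k := by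
  classical
  intro A e N u v r Rbig u₁ v₁ εu εv y z mx my' mz he hN hinj hr hA hrA hR hu₁ hv₁ hεu hεv hesc hy0 hyz hzN
    hmx hmy'L hmzL h0 hy hz hxz hmy' j hzj hjN
  have hinjr : ∀ i j, i ≤ r.length → j ≤ r.length → r.getVert i = r.getVert j → i = j :=
    fun i j hi hj h => hr.getVert_injOn (by simpa using hi) (by simpa using hj) h
  obtain ⟨Ξ, hΞs, hΞn, hΞ0, hΞe⟩ :=
    loop_build A e N r z mx mz he hinj hr hA hrA hzN hxz hmzL.le h0 hz
  -- sites off the loop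
  have hoffr : ∀ i, i ≤ r.length → (i < mx ∨ mz < i) → r.getVert i ∉ Ξ.support := by
    intro i hi hi' hmem
    rcases hΞs _ hmem with h | ⟨k, hk1, hk2, hk⟩
    · exact hrA _ (r.getVert_mem_support i) h
    · have := hinjr i k hi (by omega) hk
      omega
  have hoffesc : ∀ z' : Site 2, (z' ∉ A ∧ ∀ n, 0 < n → n < r.length → z' ≠ r.getVert n) → z' ∉ Ξ.support := by
    rintro z' ⟨h1, h2⟩ hmem
    rcases hΞs _ hmem with h | ⟨k, hk1, hk2, hk⟩
    · exact h1 h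
    · exact h2 k (by omega) (by omega) hk
  -- the loop lies to the left of the column `Rbig - 2`, where escapes end: escaping sites read zero
  have hΞR : ∀ z' ∈ Ξ.support, z' 0 ≤ Rbig - 2 := by
    intro z' hz'
    rcases hΞs _ hz' with h | ⟨k, -, -, rfl⟩
    · have := hR z' (Or.inl h); omega
    · have := hR _ (Or.inr (r.getVert_mem_support k)); omega
  have hzero : ∀ (c c' : Site 2) (ε : (zdGraph 2).Walk c c'), Rbig ≤ c' 0 →
      (∀ z' ∈ ε.support, z' ∉ A ∧ ∀ n, 0 < n → n < r.length → z' ≠ r.getVert n) → walkWinding Ξ c = 0 := by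
    intro c c' ε hc' hε
    rw [walkWinding_eq_of_walk_closed Ξ ε fun z' hz' => hoffesc z' (hε z' hz')]
    exact walkWinding_eq_zero_of_right hΞR (by omega)
  -- `r`-vertices before `mx` / after `mz` read zero (along `r` to an endpoint, then escape)
  have htail_lt : ∀ k, k < mx → walkWinding Ξ (r.getVert k) = 0 := by
    intro k hk
    obtain ⟨q₀, -, hq₀s, -⟩ := triple_slice hr (Nat.zero_le k)
    rw [← walkWinding_eq_of_walk_closed Ξ q₀ fun z' hz' => ?_, r.getVert_zero]
    · exact hzero u u₁ εu hu₁ hεu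
    · obtain ⟨i, -, hik, rfl⟩ := hq₀s z' hz'
      exact hoffr i (by omega) (Or.inl (by omega))
  have htail_gt : ∀ k, mz < k → k ≤ r.length → walkWinding Ξ (r.getVert k) = 0 := by
    intro k hk hkL
    obtain ⟨q₁, -, hq₁s, -⟩ := triple_slice hr hkL
    rw [walkWinding_eq_of_walk_closed Ξ q₁ fun z' hz' => ?_, r.getVert_length]
    · exact hzero v v₁ εv hv₁ hεv
    · obtain ⟨i, hki, hiL, rfl⟩ := hq₁s z' hz'
      exact hoffr i hiL (Or.inr (by omega))
  -- the two arcs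
  have harc1 : ∀ j', 1 ≤ j' → j' ≤ z → walkWinding Ξ (cornerFace (btour (↑A : Set (Site 2)) e j')) =
      walkWinding Ξ (cornerFace (btour (↑A : Set (Site 2)) e 1)) :=
    loop_arc_const Ξ _ e fun j' hj' hj'z => hΞe j' (by omega) (by omega) (by omega)
  have harc2 : ∀ j', z + 1 ≤ j' → j' ≤ N → walkWinding Ξ (cornerFace (btour (↑A : Set (Site 2)) e j')) =
      walkWinding Ξ (cornerFace (btour (↑A : Set (Site 2)) e (z + 1))) :=
    loop_arc_const Ξ _ e fun j' hj' hj'N => hΞe j' (by omega) hj'N (by omega)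
  -- the jump across the primal edge of `e`
  have hjump : walkWinding Ξ (cornerFace e) ≠ walkWinding Ξ (cornerFace (btour (↑A : Set (Site 2)) e 1)) := by
    have hF1 : cornerFace (btour (↑A : Set (Site 2)) e 1) = cornerFace e + e.2.ccw.vec := by
      simpa using cornerFace_btour_succ (↑A : Set (Site 2)) e 0
    rw [hF1]
    refine abab_walkWinding_ne_of_sepEdge_mem hΞn (adj_cornerFace_add e) ?_
    rw [loop_sepEdge_cornerFace]
    exact hΞ0
  -- the first arc reads zero at the contact of `y`
  have hW1 : walkWinding Ξ (cornerFace (btour (↑A : Set (Site 2)) e 1)) = 0 := by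
    have hoffy : bcontact (btour (↑A : Set (Site 2)) e y) ∉ Ξ.support := by
      rw [hy]; exact hoffr my' hmy'L.le (by omega)
    rw [← harc1 y hy0 hyz.le, loop_face_contact Ξ _ hoffy, hy]
    rcases hmy' with h | h
    · exact htail_lt my' h
    · exact htail_gt my' h hmy'L.le
  -- hence the second arc reads a nonzero value
  have hW2 : walkWinding Ξ (cornerFace (btour (↑A : Set (Site 2)) e j)) ≠ 0 := by
    rw [harc2 j hzj hjN.le, ← harc2 N (by omega) le_rfl, hN, ← hW1]
    exact hjump
  -- a contact of the second arc off `r[mx .. mz]` would read zero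
  by_contra H
  have hej := bcontact_spec _ (btour_isBEdge (↑A : Set (Site 2)) he j)
  have hcoff : bcontact (btour (↑A : Set (Site 2)) e j) ∉ Ξ.support := fun hmem => by
    rcases hΞs _ hmem with h | ⟨k, hk1, hk2, hk⟩
    · exact hej.2.1 h
    · exact H ⟨k, hk1, hk2, hk⟩
  rw [loop_face_contact Ξ _ hcoff] at hW2
  by_cases hint : ∃ n, 0 < n ∧ n < r.length ∧ bcontact (btour (↑A : Set (Site 2)) e j) = r.getVert n
  · obtain ⟨n, -, hnL, hn⟩ := hint
    rw [hn] at hW2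
    rcases lt_or_ge n mx with h | h
    · exact hW2 (htail_lt n h)
    rcases lt_or_ge mz n with h' | h'
    · exact hW2 (htail_gt n h' hnL.le)
    · exact H ⟨n, h, h', hn⟩
  · push Not at hint
    obtain ⟨c', ε, hc', hε⟩ := hesc _ hej.2.1 (fun n hn0 hnL => hint n hn0 hnL) ⟨_, hej.1, hej.2.2⟩
    exact hW2 (hzero _ c' ε hc' hε)

end Summit.CriticalPhenomena.SAWScalingLimit.Theorems.FKGToTraversalBound.SlitNecklace

end
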